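import Summits.AnomalousDissipation.AnomalousDissipation.Theorems.SolenoidalFractalHomogenisationLagrangianStepVmodSSRegimesA
import Summits.AnomalousDissipation.AnomalousDissipation.Theorems.SolenoidalFractalHomogenisationLagrangianStepVmodSSScalars
import Summits.AnomalousDissipation.AnomalousDissipation.Theorems.SolenoidalFractalHomogenisationLagrangianStepVmodPairV
import HarnessLib

/-!
# K1L_D (stmt-AnomalousDissipation-27980): (V_mod) flat stage, block (ss) — REGIME LEMMAS IN THE FINAL CURRENCY, part C:
# the (V)-comparison regime (tool T-V) on windows `P < τ`, `Rτ ≤ 2`, for labels within the clause's scale (`‖ℓ‖⌈K/ν⌉ ≤ n`)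
(helper; `--supports 27980 --as helper`; prover ad-sawtooth-k1loc-p1 g15; rows «coarse, τ > P, before the grid step» of the certifier's table
`Cruxes/LagrangianRenormalisationStep/Lines/onelevel-ss-regimes.md`; target currency = `VmodFlat.SSMode_textEH`.)

Notation as in parts A/B (`R = 8π²·loT·|ℓ|²`, `τ = t − s`, `P = M·W.period/ν`, `y = P/τ`, allowance `A(τ) = C₁(C₁(ν^e + (⌈K/ν⌉/n)^e) + (min 1 y)^e)`).
* `RP_ge` — `R·P ≥ 8π²(lo/Λ)(M·Wp)·c·(|ℓ|²/(n²ν²))`;  `g_sq_le` — `g² ≤ κ₀·RP`, `g = ‖ℓ‖⌈K/ν⌉/n`, `κ₀ = (K+1)²/(8π²(lo/Λ)·M·Wp·c)`;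
* `rpow_le_of_sq_le` — `g² ≤ a·y`, `0 < y ≤ 1`, `e ≤ σ/2` ⟹ `g^σ ≤ a^{σ/2}·y^e`;
* **`defect_le_alw_of_scale_mid`** — from `…VmodPairV.norm_fc_sub_le_of_clauseV` ((V) un-squared): with `r₀ = hiΛ²/lo` (`ξ = r₀R`),
  `min 1 (ξτ) ≤ r₀Rτ ≤ 4r₀·dW`, `ν^σ ≤ ν^e`, `g^σ ≤ (2κ₀)^{σ/2}y^e`, `ξP = r₀(Rτ)y ≤ 4r₀·dW·y^e`:
  the target inequality with `C₁² ≥ 8√2r₀C²`, `C₁ ≥ 8√2r₀(C²(2κ₀)^{σ/2} + C)`, `e ≤ min(σ/2, 1)`.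
`sorry`-free; NOT a proof of (ss), of the stub, of K1L_D or of AD; rung F-D1.A0.
-/

set_option linter.dupNamespace false

noncomputable section

namespace Summit.AnomalousDissipation.AnomalousDissipation.Theorems.SolenoidalFractalHomogenisation.LagrangianStep.VmodGen

open Set MeasureTheory Complex UnitAddTorus
open scoped InnerProductSpace ENNReal
open Literature.Analysis Literature.Analysis.FunctionSpaces Literature.Analysis.FunctionSpaces.Torus
open Literature.Analysis.FluidPDE Literature.Analysis.FluidPDE.Torus Literature.Analysis.FluidPDE.LatticeShear
open Summit.AnomalousDissipation.AnomalousDissipation.Theorems.SolenoidalFractalHomogenisation.LagrangianStep.VmodFlat (fc fc_sub loT dW)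

/-! ## §1 Scalar tools -/

/-- `R·P ≥ 8π²(lo/Λ)(M·Wp)·c·(|ℓ|²/(n²ν²))` (`R = 8π²·loT·|ℓ|²`, `P = M·Wp/ν`; keeps only the `c/ν` part of `ν + c/ν`). -/
theorem RP_ge {lo Λ c M Wp ν : ℝ} {n : ℕ} (hloΛ : 0 ≤ lo / Λ) (hMW : 0 ≤ M * Wp) (hν : 0 < ν) (hn : 1 ≤ n)
    (ℓ : Fin 3 → ℤ) :
    8 * Real.pi ^ 2 * (lo / Λ) * (M * Wp) * c * (Torus.freqNormSq ℓ / ((n:ℝ) ^ 2 * ν ^ 2))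
      ≤ 8 * Real.pi ^ 2 * loT lo Λ c ν n * Torus.freqNormSq ℓ * (M * Wp / ν) := by
  have hn0 : (0:ℝ) < n := by exact_mod_cast (show 0 < n from hn)
  have hq0 := Torus.freqNormSq_nonneg ℓ
  unfold loT
  have h1 : 8 * Real.pi ^ 2 * ((1 / (n:ℝ) ^ 2) * ((c / ν) * (lo / Λ))) * Torus.freqNormSq ℓ * (M * Wp / ν)
      ≤ 8 * Real.pi ^ 2 * ((1 / (n:ℝ) ^ 2) * ((ν + c / ν) * (lo / Λ))) * Torus.freqNormSq ℓ * (M * Wp / ν) := by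
    have : c / ν ≤ ν + c / ν := by linarith
    have h3 : (1 / (n:ℝ) ^ 2) * ((c / ν) * (lo / Λ)) ≤ (1 / (n:ℝ) ^ 2) * ((ν + c / ν) * (lo / Λ)) :=
      mul_le_mul_of_nonneg_left (mul_le_mul_of_nonneg_right this hloΛ) (by positivity)
    exact mul_le_mul_of_nonneg_right (mul_le_mul_of_nonneg_right (mul_le_mul_of_nonneg_left h3 (by positivity)) hq0)
      (by positivity)
  refine le_trans (le_of_eq ?_) h1
  field_simp

/-- `g² ≤ κ₀·RP` for `g = ‖ℓ‖⌈K/ν⌉/n`, `κ₀ = (K+1)²/(8π²(lo/Λ)·M·Wp·c)` (`0 < ν ≤ 1`, `0 ≤ K`, `lo/Λ, M·Wp, c > 0`). -/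
theorem g_sq_le {lo Λ c M Wp ν K : ℝ} {n : ℕ} (hloΛ : 0 < lo / Λ) (hc : 0 < c) (hMW : 0 < M * Wp) (hν : 0 < ν) (hν1 : ν ≤ 1)
    (hK : 0 ≤ K) (hn : 1 ≤ n) (ℓ : Fin 3 → ℤ) :
    (‖Torus.latticeVec ℓ‖ * (⌈K / ν⌉₊ : ℝ) / n) ^ 2
      ≤ (K + 1) ^ 2 / (8 * Real.pi ^ 2 * (lo / Λ) * (M * Wp) * c) * (8 * Real.pi ^ 2 * loT lo Λ c ν n * Torus.freqNormSq ℓ * (M * Wp / ν)) := by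
  have hn0 : (0:ℝ) < n := by exact_mod_cast (show 0 < n from hn)
  have hceil : (⌈K / ν⌉₊ : ℝ) ≤ (K + 1) / ν := by
    have h1 := (Nat.ceil_lt_add_one (div_nonneg hK hν.le : 0 ≤ K / ν)).le
    have h2 : K / ν + 1 ≤ (K + 1) / ν := by
      rw [add_div]; have : (1:ℝ) ≤ 1 / ν := by rw [le_div_iff₀ hν]; linarith
      linarith
    exact h1.trans h2
  have hL0 := norm_nonneg (Torus.latticeVec ℓ)
  have h1 : ‖Torus.latticeVec ℓ‖ * (⌈K / ν⌉₊ : ℝ) / n ≤ ‖Torus.latticeVec ℓ‖ * ((K + 1) / ν) / n :=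
    div_le_div_of_nonneg_right (mul_le_mul_of_nonneg_left hceil hL0) hn0.le
  have h2 : (‖Torus.latticeVec ℓ‖ * (⌈K / ν⌉₊ : ℝ) / n) ^ 2 ≤ (‖Torus.latticeVec ℓ‖ * ((K + 1) / ν) / n) ^ 2 :=
    pow_le_pow_left₀ (by positivity) h1 2
  refine h2.trans ?_
  have h3 := mul_le_mul_of_nonneg_left (RP_ge (c := c) hloΛ.le hMW.le hν hn ℓ)
    (by positivity : 0 ≤ (K + 1) ^ 2 / (8 * Real.pi ^ 2 * (lo / Λ) * (M * Wp) * c))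
  refine le_trans (le_of_eq ?_) h3
  have hlo0 : lo ≠ 0 := by rintro rfl; simp at hloΛ
  have hΛ0 : Λ ≠ 0 := by rintro rfl; simp at hloΛ
  have hM0 : M ≠ 0 := by rintro rfl; simp at hMW
  have hWp0 : Wp ≠ 0 := by rintro rfl; simp at hMW
  rw [div_pow, mul_pow, norm_latticeVec_sq_eq]
  field_simp

/-- From `g² ≤ a·y` with `0 ≤ g`, `0 ≤ a`, `0 < y ≤ 1`, `0 ≤ σ` and `e ≤ σ/2`: `g^σ ≤ a^{σ/2}·y^e`. -/
theorem rpow_le_of_sq_le {g a y σ e : ℝ} (hg : 0 ≤ g) (ha : 0 ≤ a) (hy0 : 0 < y) (hy1 : y ≤ 1) (hσ : 0 ≤ σ) (he : e ≤ σ / 2)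
    (h : g ^ 2 ≤ a * y) : g ^ σ ≤ a ^ (σ / 2) * y ^ e := by
  have hay : 0 ≤ a * y := mul_nonneg ha hy0.le
  have h1 : g ≤ Real.sqrt (a * y) := Real.le_sqrt_of_sq_le h
  have h2 : g ^ σ ≤ (Real.sqrt (a * y)) ^ σ := Real.rpow_le_rpow hg h1 hσ
  have h3 : (Real.sqrt (a * y)) ^ σ = (a * y) ^ (σ / 2) := by
    rw [Real.sqrt_eq_rpow, ← Real.rpow_mul hay]; congr 1; ring
  have h4 : (a * y) ^ (σ / 2) = a ^ (σ / 2) * y ^ (σ / 2) := Real.mul_rpow ha hy0.le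
  have h5 : y ^ (σ / 2) ≤ y ^ e := Real.rpow_le_rpow_of_exponent_ge hy0 hy1 he
  rw [h3, h4] at h2
  exact h2.trans (mul_le_mul_of_nonneg_left h5 (Real.rpow_nonneg ha _))

/-! ## §2 The (V)-comparison regime -/

section Clause

variable {k : ℕ} {W : LatticeWord k} {M : ℝ} {hM : 0 < M} {c : ℝ}
  {Φ : ℝ → Visc4 (Fin 3) → Visc4 (Fin 3)} {lo hi Λ β σ C ν₀ K : ℝ}
  {ν : ℝ} {n : ℕ} {𝔸 : Visc4 (Fin 3)} {Tw : ℝ} {U T : ℝ → ℝ → (V2 →L[ℝ] V2)}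

set_option maxHeartbeats 1600000 in
/-- **THE (V)-COMPARISON REGIME** (labels within scale `‖ℓ‖⌈K/ν⌉ ≤ n`, `ℓ ∈ freqBall Lb`, `2Lb < n`; windows `P < τ`, `Rτ ≤ 2`):
the target inequality with `C₁² ≥ 8√2·r₀·C²`, `C₁ ≥ 8√2·r₀·(C²(2κ₀)^{σ/2} + C)` (`r₀ = hiΛ²/lo`, `κ₀ = (K+1)²/(8π²(lo/Λ)M·Wp·c)`),
`e ≤ σ/2`, `e ≤ 1`. -/
theorem defect_le_alw_of_scale_mid (hV : SlowVectorClauseF W M hM c Φ lo hi Λ β σ C ν₀ K)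
    (hlo : 0 < lo) (hhi : 0 ≤ hi) (hΛ : 1 ≤ Λ) (hc : 0 < c) (hC : 0 ≤ C) (hσ : 0 < σ) (hK : 0 ≤ K)
    (hν : ν ∈ Set.Ioo 0 ν₀) (hν1 : ν ≤ 1) (hn : 1 ≤ n) (hodd : OddSmall 𝔸 (ν * β))
    (hwin : ∃ lam ∈ Set.Icc (1:ℝ) Λ, NearIso 𝔸 (ν * (lo / lam)) (ν * (hi * lam)))
    (hΦw : ∃ lam ∈ Set.Icc (1:ℝ) Λ, NearIso (Φ ν ((1 / ν) • 𝔸)) (lo / lam) (hi * lam))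
    (hU : IsPropagator Tw (cellField W M hM ν hν.1 n) ((1 / (n:ℝ) ^ 2) • 𝔸) U)
    (hT : IsPropagator Tw (fun (_ : ℝ) (_ : UnitAddTorus (Fin 3)) => (0 : EuclideanSpace ℝ (Fin 3)))
      ((1 / (n:ℝ) ^ 2) • (𝔸 + (c / ν) • Φ ν ((1 / ν) • 𝔸))) T)
    {s t : ℝ} (hs : 0 ≤ s) (hst : s < t) (htT : t ≤ Tw) (hphase : ∀ τ, cellField W M hM ν hν.1 n (s + τ) = cellField W M hM ν hν.1 n τ)
    {Lb : ℕ} (hLb : 2 * Lb < n) {ℓ : Fin 3 → ℤ} (hℓ0 : ℓ ≠ 0) (hℓL : ℓ ∈ Torus.freqBall (d := Fin 3) Lb)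
    (hscale : ‖Torus.latticeVec ℓ‖ * (⌈K / ν⌉₊ : ℝ) ≤ n)
    (v : V2) (hv : v ∈ divFreeL2 (Fin 3)) (hvs : ∀ k', k' ≠ ℓ → k' ≠ -ℓ → fc v k' = 0)
    {C₁ e : ℝ} (hC₁0 : 0 ≤ C₁) (hC₁a : 8 * Real.sqrt 2 * (hi * Λ ^ 2 / lo) * C ^ 2 ≤ C₁ * C₁)
    (hC₁b : 8 * Real.sqrt 2 * (hi * Λ ^ 2 / lo) *
      (C ^ 2 * (2 * ((K + 1) ^ 2 / (8 * Real.pi ^ 2 * (lo / Λ) * (M * W.period) * c))) ^ (σ / 2) + C) ≤ C₁)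
    (heσ : e ≤ σ / 2) (he1 : e ≤ 1)
    (hRτ : 8 * Real.pi ^ 2 * loT lo Λ c ν n * Torus.freqNormSq ℓ * (t - s) ≤ 2) (hτP : M * W.period / ν < t - s) :
    ‖fc (U s t v - T s t v) ℓ‖
      ≤ (C₁ * (C₁ * (ν ^ e + ((⌈K / ν⌉₊ : ℝ) / n) ^ e) + (min 1 ((M * W.period / ν) / (t - s))) ^ e))
        * dW lo Λ c ν n (t - s) ℓ * ‖fc v ℓ‖ := by
  have hτ0 : 0 < t - s := by linarith
  have hsT : s < Tw := lt_of_lt_of_le hst htT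
  have hn0 : (0:ℝ) < n := by exact_mod_cast (show 0 < n from hn)
  have hΛ0 : 0 < Λ := lt_of_lt_of_le one_pos hΛ
  have hWp := PermissibleCarrier.period_pos W
  have hMW : 0 < M * W.period := mul_pos hM hWp
  have hP0 : 0 < M * W.period / ν := div_pos hMW hν.1
  have hloΛ : 0 < lo / Λ := div_pos hlo hΛ0
  -- ### the (V) bound, un-squared
  have hpair := norm_fc_sub_le_of_clauseV hV hlo hhi hΛ hc.le hC hν hn hodd hwin hΦw hU hT hs hsT hphase hst.le htT hLb hℓ0 hℓL
    hscale v hv hvs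
  -- ### names
  set R : ℝ := 8 * Real.pi ^ 2 * loT lo Λ c ν n * Torus.freqNormSq ℓ with hR
  set ξ : ℝ := 8 * Real.pi ^ 2 * ‖Torus.latticeVec ℓ‖ ^ 2 * (hi * Λ) * (ν + c / ν) / (n:ℝ) ^ 2 with hξ
  set g : ℝ := ‖Torus.latticeVec ℓ‖ * (⌈K / ν⌉₊ : ℝ) / n with hg
  set P : ℝ := M * W.period / ν with hP
  set y : ℝ := P / (t - s) with hy
  set r₀ : ℝ := hi * Λ ^ 2 / lo with hr₀
  set κ₀ : ℝ := (K + 1) ^ 2 / (8 * Real.pi ^ 2 * (lo / Λ) * (M * W.period) * c) with hκ₀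
  have hr₀0 : 0 ≤ r₀ := by rw [hr₀]; positivity
  have hκ₀0 : 0 ≤ κ₀ := by rw [hκ₀]; positivity
  have hg0 : 0 ≤ g := by rw [hg]; positivity
  have hy0 : 0 < y := div_pos hP0 hτ0
  have hy1 : y ≤ 1 := (div_le_one hτ0).2 hτP.le
  have hR0 : 0 ≤ R := by
    rw [hR]; unfold loT
    have := freqNormSq_nonneg ℓ; have := hν.1; have : 0 ≤ ν + c / ν := by positivity
    positivity
  have hRτ0 : 0 ≤ R * (t - s) := mul_nonneg hR0 hτ0.le
  -- `ξ = r₀·R`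
  have hξR : ξ = r₀ * R := by
    rw [hξ, hr₀, hR, norm_latticeVec_sq_eq]; unfold loT; field_simp
  -- `dW ≥ Rτ/4`
  have hdW : R * (t - s) / 4 ≤ dW lo Λ c ν n (t - s) ℓ := by
    have h := one_sub_exp_neg_ge hRτ0
    have hmin : R * (t - s) / 2 ≤ min 1 (R * (t - s)) := le_min (by rw [hR] at *; linarith) (by linarith)
    unfold dW
    rw [show 8 * Real.pi ^ 2 * loT lo Λ c ν n * Torus.freqNormSq ℓ * (t - s) = R * (t - s) by rw [hR]]
    linarith
  have hdW0 : 0 ≤ dW lo Λ c ν n (t - s) ℓ := le_trans (by positivity) hdW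
  -- `ν^σ ≤ ν^e`, `g^σ ≤ (2κ₀)^{σ/2} y^e`, `y ≤ y^e`
  have hνσ : ν ^ σ ≤ ν ^ e := Real.rpow_le_rpow_of_exponent_ge hν.1 hν1 (heσ.trans (by linarith))
  have hg2 : g ^ 2 ≤ (2 * κ₀) * y := by
    have h1 : g ^ 2 ≤ κ₀ * (R * P) := by rw [hg, hκ₀, hR, hP]; exact g_sq_le hloΛ hc hMW hν.1 hν1 hK hn ℓ
    have h2 : R * P = R * (t - s) * y := by rw [hy]; field_simp
    rw [h2] at h1
    have h3 : κ₀ * (R * (t - s) * y) ≤ κ₀ * (2 * y) :=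
      mul_le_mul_of_nonneg_left (mul_le_mul_of_nonneg_right (by rw [hR]; exact hRτ) hy0.le) hκ₀0
    linarith
  have hgσ : g ^ σ ≤ (2 * κ₀) ^ (σ / 2) * y ^ e := rpow_le_of_sq_le hg0 (by positivity) hy0 hy1 hσ.le heσ hg2
  have hye : y ≤ y ^ e := by have h := Real.rpow_le_rpow_of_exponent_ge hy0 hy1 he1; rwa [Real.rpow_one] at h
  -- ### the bracket of the (V) bound ≤ r₀·(Rτ)·(C²ν^e + (C²(2κ₀)^{σ/2} + C)·y^e)
  have hmin1 : min 1 (ξ * (t - s)) ≤ r₀ * (R * (t - s)) := (min_le_right _ _).trans (le_of_eq (by rw [hξR]; ring))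
  have hξP : ξ * P = r₀ * (R * (t - s)) * y := by rw [hξR, hy]; field_simp
  have hGe0 : 0 ≤ (2 * κ₀) ^ (σ / 2) * y ^ e := mul_nonneg (Real.rpow_nonneg (by positivity) _) (Real.rpow_nonneg hy0.le _)
  have hbr : C * (C * (ν ^ σ + g ^ σ) * min 1 (ξ * (t - s)) + ξ * P)
      ≤ r₀ * (R * (t - s)) * (C ^ 2 * ν ^ e + (C ^ 2 * (2 * κ₀) ^ (σ / 2) + C) * y ^ e) := by
    have h1 : C * (ν ^ σ + g ^ σ) * min 1 (ξ * (t - s)) ≤ C * (ν ^ e + (2 * κ₀) ^ (σ / 2) * y ^ e) * (r₀ * (R * (t - s))) :=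
      mul_le_mul (mul_le_mul_of_nonneg_left (add_le_add hνσ hgσ) hC) hmin1 (le_min zero_le_one (by
        rw [hξR]; exact mul_nonneg (mul_nonneg hr₀0 hR0) hτ0.le)) (mul_nonneg hC (add_nonneg (Real.rpow_nonneg hν.1.le _) hGe0))
    rw [hξP, mul_add]
    have h2 : r₀ * (R * (t - s)) * y ≤ r₀ * (R * (t - s)) * y ^ e := mul_le_mul_of_nonneg_left hye (mul_nonneg hr₀0 hRτ0)
    have h3 := add_le_add (mul_le_mul_of_nonneg_left h1 hC) (mul_le_mul_of_nonneg_left h2 hC)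
    refine h3.trans (le_of_eq ?_)
    ring
  -- ### … ≤ 4 r₀ dW · (…) ≤ (C₁²ν^e + C₁ y^e)·dW /(2√2)
  have hX0 : 0 ≤ C ^ 2 * ν ^ e + (C ^ 2 * (2 * κ₀) ^ (σ / 2) + C) * y ^ e := by
    have := Real.rpow_nonneg hν.1.le e; positivity
  have hv0 := norm_nonneg (fc v ℓ)
  have hmin_y : min 1 (M * W.period / ν / (t - s)) = y := by rw [hy, hP]; exact min_eq_right (by rw [← hP]; exact hy1)
  have halw : 2 * Real.sqrt 2 * (r₀ * (4 * dW lo Λ c ν n (t - s) ℓ) * (C ^ 2 * ν ^ e + (C ^ 2 * (2 * κ₀) ^ (σ / 2) + C) * y ^ e))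
      ≤ (C₁ * (C₁ * (ν ^ e + ((⌈K / ν⌉₊ : ℝ) / n) ^ e) + (min 1 ((M * W.period / ν) / (t - s))) ^ e)) * dW lo Λ c ν n (t - s) ℓ := by
    rw [hmin_y]
    have hue : 0 ≤ ((⌈K / ν⌉₊ : ℝ) / n) ^ e := Real.rpow_nonneg (by positivity) e
    have hνe0 : 0 ≤ ν ^ e := Real.rpow_nonneg hν.1.le e
    have hye0 : 0 ≤ y ^ e := Real.rpow_nonneg hy0.le e
    -- coefficient comparison
    have h1 : 8 * Real.sqrt 2 * r₀ * C ^ 2 * ν ^ e ≤ C₁ * C₁ * ν ^ e := mul_le_mul_of_nonneg_right (by rw [hr₀]; linarith) hνe0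
    have h2 : 8 * Real.sqrt 2 * r₀ * (C ^ 2 * (2 * κ₀) ^ (σ / 2) + C) * y ^ e ≤ C₁ * y ^ e :=
      mul_le_mul_of_nonneg_right (by rw [hr₀, hκ₀]; linarith) hye0
    have h3 : 0 ≤ C₁ * C₁ * ((⌈K / ν⌉₊ : ℝ) / n) ^ e := by positivity
    have h4 : 2 * Real.sqrt 2 * (r₀ * 4 * (C ^ 2 * ν ^ e + (C ^ 2 * (2 * κ₀) ^ (σ / 2) + C) * y ^ e))
        ≤ C₁ * (C₁ * (ν ^ e + ((⌈K / ν⌉₊ : ℝ) / n) ^ e) + y ^ e) := by nlinarith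
    have := mul_le_mul_of_nonneg_right h4 hdW0
    refine le_trans (le_of_eq (by ring)) this
  calc ‖fc (U s t v - T s t v) ℓ‖
      ≤ 2 * Real.sqrt 2 * (C * (C * (ν ^ σ + g ^ σ) * min 1 (ξ * (t - s)) + ξ * P)) * ‖fc v ℓ‖ := hpair
    _ ≤ 2 * Real.sqrt 2 * (r₀ * (R * (t - s)) * (C ^ 2 * ν ^ e + (C ^ 2 * (2 * κ₀) ^ (σ / 2) + C) * y ^ e)) * ‖fc v ℓ‖ :=
        mul_le_mul_of_nonneg_right (mul_le_mul_of_nonneg_left hbr (by positivity)) hv0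
    _ ≤ 2 * Real.sqrt 2 * (r₀ * (4 * dW lo Λ c ν n (t - s) ℓ) * (C ^ 2 * ν ^ e + (C ^ 2 * (2 * κ₀) ^ (σ / 2) + C) * y ^ e)) * ‖fc v ℓ‖ := by
        refine mul_le_mul_of_nonneg_right (mul_le_mul_of_nonneg_left ?_ (by positivity)) hv0
        exact mul_le_mul_of_nonneg_right (mul_le_mul_of_nonneg_left (by linarith) hr₀0) hX0
    _ ≤ _ := mul_le_mul_of_nonneg_right halw hv0

end Clause

end Summit.AnomalousDissipation.AnomalousDissipation.Theorems.SolenoidalFractalHomogenisation.LagrangianStep.VmodGen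

end
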